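import Summits.QuantumFields.QCD.Theses.SpectralDefectExtinction
import Summits.QuantumFields.QCD.Theorems.ExtinctionBuildsQCD.Negative.ChiralInertia
import Literature.MathematicalPhysics.QuantumLattice.SectorEigenvalueContinuation

/-!
# Stub `stub_wellBudget` (W1) of line `block-away-the-sign`
(crux `Summit.QuantumFields.QCD.Theses.SpectralDefectExtinction.ExtinctionBuildsQCD`, item stmt-QuantumFields-18064)

The MIN–MAX WELL BUDGET of the sparse-window-wells module (pure finite-dimensional linear algebra):
`k` vectors `φ a` with pairwise disjoint supports and pairwise orthogonal `H`-images, each a strict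
quasi-mode of the Hermitian matrix `H` below level `E > 0` (`‖H φ‖² < E² ‖φ‖²`), force at least `k`
eigenvalues of `H` in `(−E, E)`, counted with multiplicity as roots of `charpoly H`.

Proof (dimension count in the eigenbasis `U = hH.eigenvectorUnitary` of `H`): on the span
`V = {Σ cₐ φₐ}` one has `‖H v‖² = Σ |cₐ|² ‖H φₐ‖² < E² Σ |cₐ|² ‖φₐ‖² = E² ‖v‖²` for `c ≠ 0`
(Pythagoras twice), while in eigen-coordinates `w = Uᴴ v` one has `‖v‖² = ‖w‖²` and
`‖H v‖² = Σᵢ λᵢ² |wᵢ|²`; so the linear map `c ↦ (wᵢ)_{|λᵢ| < E}` is injective (a kernel vector would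
have `‖H v‖² = Σ_{|λᵢ| ≥ E} λᵢ² |wᵢ|² ≥ E² ‖v‖²`), whence `k ≤ #{i | |λᵢ| < E}`, which is the root count
by `Negative.countP_roots_charpoly_eq_card`.  Same architecture as the landed Sylvester direction
`Negative.card_le_card_eigenvalues_of_form_pos` (Horn–Johnson, *Matrix Analysis*, §4.3 Courant–Fischer).

The Pythagoras helpers are adapted (with attribution; the source module is a non-importable sketch) from
`Summits/QuantumFields/QCD/Cruxes/ExtinctionBuildsQCD/Sketch_sparse_window_wells.lean`; `Re ⟨u, u⟩ = Σ ‖uᵢ‖²`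
is the tree's `Literature.MathematicalPhysics.QuantumLattice.EigenvalueContinuation.re_star_dotProduct_self`.
-/

noncomputable section

namespace Summit.QuantumFields.QCD.Cruxes.ExtinctionBuildsQCD.BlockAwayTheSign

open scoped BigOperators Topology Classical MeasureTheory Matrix
open Filter MeasureTheory Matrix
open Summit.QuantumFields.QCD.Theorems.ExtinctionBuildsQCD.Negative (countP_roots_charpoly_eq_card)
open Literature.MathematicalPhysics.QuantumLattice.EigenvalueContinuation (re_star_dotProduct_self)

/-! ## Pythagoras identities -/

section WellBudgetLemmas

variable {ι : Type*} [Fintype ι]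

-- adapted from Cruxes/ExtinctionBuildsQCD/Sketch_sparse_window_wells.lean:star_dotProduct_sum_smul_of_orthogonal
/-- Pythagoras for a finite family of pairwise orthogonal complex vectors with coefficients:
`⟨Σ cₐuₐ, Σ cₐuₐ⟩ = Σₐ c̄ₐ cₐ ⟨uₐ, uₐ⟩`. [folklore] -/
theorem wellBudget_star_dotProduct_sum_smul {k : ℕ} (u : Fin k → ι → ℂ) (c : Fin k → ℂ)
    (horth : ∀ a b, a ≠ b → star (u a) ⬝ᵥ u b = 0) :
    star (∑ a, c a • u a) ⬝ᵥ (∑ a, c a • u a) = ∑ a, (star (c a) * c a) * (star (u a) ⬝ᵥ u a) := by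
  rw [star_sum, sum_dotProduct]
  refine Finset.sum_congr rfl fun a _ => ?_
  rw [star_smul, dotProduct_sum, Finset.sum_eq_single a]
  · rw [smul_dotProduct, dotProduct_smul, smul_eq_mul, smul_eq_mul]; ring
  · intro b _ hba
    rw [smul_dotProduct, dotProduct_smul, horth a b (Ne.symm hba), smul_zero, smul_zero]
  · intro h; exact absurd (Finset.mem_univ a) h

-- adapted from Cruxes/ExtinctionBuildsQCD/Sketch_sparse_window_wells.lean:re_star_dotProduct_sum_smul_of_orthogonal
/-- Real part of the Pythagoras identity: `Re ⟨Σ cₐuₐ, Σ cₐuₐ⟩ = Σₐ ‖cₐ‖² ‖uₐ‖²` for pairwise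
orthogonal `uₐ`. [folklore] -/
theorem wellBudget_re_star_dotProduct_sum_smul {k : ℕ} (u : Fin k → ι → ℂ) (c : Fin k → ℂ)
    (horth : ∀ a b, a ≠ b → star (u a) ⬝ᵥ u b = 0) :
    (star (∑ a, c a • u a) ⬝ᵥ (∑ a, c a • u a)).re = ∑ a, ‖c a‖ ^ 2 * ∑ i, ‖u a i‖ ^ 2 := by
  rw [wellBudget_star_dotProduct_sum_smul u c horth, Complex.re_sum]
  refine Finset.sum_congr rfl fun a _ => ?_
  rw [Complex.star_def, Complex.conj_mul', ← re_star_dotProduct_self,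
    ← Complex.ofReal_pow, Complex.re_ofReal_mul]

/-! ## Norms in eigen-coordinates and the dimension count -/

variable [DecidableEq ι]

/-- **Norms in eigen-coordinates.** For a Hermitian `H = U diag(λ) Uᴴ` (Mathlib's
`eigenvectorUnitary`) and `w = Uᴴ v`: `‖v‖² = ‖w‖²` and `‖H v‖² = Σᵢ λᵢ² ‖wᵢ‖²`. [folklore] -/
theorem wellBudget_normSq_eigencoords {H : Matrix ι ι ℂ} (hH : H.IsHermitian) (v : ι → ℂ) :
    ∑ i, ‖v i‖ ^ 2 = ∑ i, ‖((hH.eigenvectorUnitary : Matrix ι ι ℂ)ᴴ *ᵥ v) i‖ ^ 2 ∧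
    ∑ i, ‖(H *ᵥ v) i‖ ^ 2 =
      ∑ i, hH.eigenvalues i ^ 2 * ‖((hH.eigenvectorUnitary : Matrix ι ι ℂ)ᴴ *ᵥ v) i‖ ^ 2 := by
  set U : Matrix ι ι ℂ := (hH.eigenvectorUnitary : Matrix ι ι ℂ)
  have hof : (RCLike.ofReal ∘ hH.eigenvalues : ι → ℂ) = fun i => ((hH.eigenvalues i : ℝ) : ℂ) := rfl
  have hU : H = U * diagonal (fun i => ((hH.eigenvalues i : ℝ) : ℂ)) * Uᴴ := by
    have h := hH.spectral_theorem
    rw [Unitary.conjStarAlgAut_apply, star_eq_conjTranspose, hof] at h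
    exact h
  -- unitarity of `U`
  have hUU : U * Uᴴ = 1 := Unitary.coe_mul_star_self hH.eigenvectorUnitary
  have hUhU : Uᴴ * U = 1 := Unitary.coe_star_mul_self hH.eigenvectorUnitary
  have hiso : ∀ x : ι → ℂ, star (U *ᵥ x) ⬝ᵥ (U *ᵥ x) = star x ⬝ᵥ x := fun x => by
    rw [star_mulVec, ← dotProduct_mulVec, mulVec_mulVec, hUhU, one_mulVec]
  set w := Uᴴ *ᵥ v with hw
  have hv : v = U *ᵥ w := by rw [hw, mulVec_mulVec, hUU, one_mulVec]
  have hHv : H *ᵥ v = U *ᵥ (diagonal (fun i => ((hH.eigenvalues i : ℝ) : ℂ)) *ᵥ w) := by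
    rw [hw, mulVec_mulVec, mulVec_mulVec, ← hU]
  constructor
  · rw [← re_star_dotProduct_self v, ← re_star_dotProduct_self w, hv, hiso]
  · rw [hHv, ← re_star_dotProduct_self, hiso, re_star_dotProduct_self]
    refine Finset.sum_congr rfl fun i _ => ?_
    rw [mulVec_diagonal, norm_mul, Complex.norm_real, Real.norm_eq_abs, mul_pow, sq_abs]

/-- **Min–max well budget, abstract dimension count.** If `‖H (L c)‖² < E² ‖L c‖²` for every
`c ≠ 0` in the source of a linear map `L : (κ → ℂ) → (ι → ℂ)` (`H` Hermitian, `E ≥ 0`), then `H` has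
at least `card κ` eigenvalues `λ` with `|λ| < E` in Mathlib's enumeration `hH.eigenvalues`: the map
`c ↦ (Uᴴ L c)|_{|λ| < E}` is injective, since a kernel vector `v = L c` would have
`‖H v‖² = Σ_{|λᵢ| ≥ E} λᵢ² ‖(Uᴴ v)ᵢ‖² ≥ E² ‖v‖²`. [folklore] -/
theorem wellBudget_card_le_card_window {H : Matrix ι ι ℂ} (hH : H.IsHermitian) {E : ℝ} (hE : 0 ≤ E)
    {κ : Type*} [Fintype κ] (L : (κ → ℂ) →ₗ[ℂ] (ι → ℂ))
    (hlt : ∀ c : κ → ℂ, c ≠ 0 → ∑ i, ‖(H *ᵥ L c) i‖ ^ 2 < E ^ 2 * ∑ i, ‖L c i‖ ^ 2) :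
    Fintype.card κ ≤ (Finset.univ.filter fun i => |hH.eigenvalues i| < E).card := by
  -- adapted from Theorems/ExtinctionBuildsQCD/Negative/ChiralInertia.lean:card_le_card_eigenvalues_of_form_pos
  set U : Matrix ι ι ℂ := (hH.eigenvectorUnitary : Matrix ι ι ℂ)
  let P : Type _ := {i : ι // |hH.eigenvalues i| < E}
  -- the comparison map `c ↦ (Uᴴ L c)|_P`
  let ψ : (κ → ℂ) →ₗ[ℂ] (P → ℂ) :=
    (LinearMap.funLeft ℂ ℂ (Subtype.val : P → ι)) ∘ₗ (Matrix.mulVecLin Uᴴ) ∘ₗ L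
  have hψ : ∀ c, ψ c = fun i : P => (Uᴴ *ᵥ L c) i.val := fun c => rfl
  have hinj : Function.Injective ψ := by
    rw [← LinearMap.ker_eq_bot, LinearMap.ker_eq_bot']
    intro c hc
    by_contra hc0
    have hzero : ∀ i : ι, |hH.eigenvalues i| < E → (Uᴴ *ᵥ L c) i = 0 := fun i hi => by
      have := congrFun (hψ c ▸ hc) ⟨i, hi⟩
      simpa using this
    have hge : E ^ 2 * ∑ i, ‖L c i‖ ^ 2 ≤ ∑ i, ‖(H *ᵥ L c) i‖ ^ 2 := by
      obtain ⟨h1, h2⟩ := wellBudget_normSq_eigencoords hH (L c)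
      rw [h1, h2, Finset.mul_sum]
      refine Finset.sum_le_sum fun i _ => ?_
      by_cases hi : |hH.eigenvalues i| < E
      · rw [hzero i hi, norm_zero]; simp
      · push Not at hi
        have hE2 : E ^ 2 ≤ hH.eigenvalues i ^ 2 := by
          rw [← sq_abs (hH.eigenvalues i)]
          exact pow_le_pow_left₀ hE hi 2
        exact mul_le_mul_of_nonneg_right hE2 (by positivity)
    exact absurd (hlt c hc0) (not_lt.mpr hge)
  have h := LinearMap.finrank_le_finrank_of_injective hinj
  rw [Module.finrank_pi, Module.finrank_pi] at h
  simpa [P, Fintype.card_subtype] using h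

end WellBudgetLemmas

/-! ## The stub -/

/-- **Stub W1 (`stub_wellBudget`) — min–max well budget.** `k` vectors `φ a` with pairwise disjoint
supports (hence pairwise orthogonal) and pairwise orthogonal `H`-images, each a strict quasi-mode of
the Hermitian `H` below level `E > 0` (`‖H φ‖² < E² ‖φ‖²`, which forces `φ ≠ 0`), force
`k ≤ #{eigenvalues of H in (−E, E)}` counted with multiplicity as roots of `charpoly H`: by
Pythagoras `‖H v‖² < E² ‖v‖²` on the `k`-dimensional span of the `φ a`, and a subspace on which the
Rayleigh quotient of `H²` is `< E²` has dimension at most the number of eigenvalues `λ` of `H` with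
`λ² < E²` (min–max / Courant–Fischer, here as the dimension count `wellBudget_card_le_card_window`).
[folklore] -/
theorem stub_wellBudget : ∀ {ι : Type} [Fintype ι] [DecidableEq ι] {H : Matrix ι ι ℂ}, H.IsHermitian → ∀ (E : ℝ), 0 < E → ∀ {k : ℕ} (φ : Fin k → ι → ℂ), (∀ a b, a ≠ b → ∀ i, φ a i = 0 ∨ φ b i = 0) → (∀ a b, a ≠ b → star (H *ᵥ φ a) ⬝ᵥ (H *ᵥ φ b) = 0) → (∀ a, ∑ i, ‖(H *ᵥ φ a) i‖ ^ 2 < E ^ 2 * ∑ i, ‖φ a i‖ ^ 2) → k ≤ H.charpoly.roots.countP (fun z => |z.re| < E) := by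
  intro ι _ _ H hH E hE k φ hsupp hHorth hquasi
  -- disjoint supports ⇒ orthogonality
  have hφorth : ∀ a b, a ≠ b → star (φ a) ⬝ᵥ φ b = 0 := by
    intro a b hab
    rw [dotProduct]
    refine Finset.sum_eq_zero fun i _ => ?_
    rcases hsupp a b hab i with h | h <;> simp [h]
  -- the comparison map `c ↦ Σ cₐ φₐ` is a strict quasi-mode map below level `E`
  have key := wellBudget_card_le_card_window hH hE.le (Fintype.linearCombination ℂ φ) ?_
  · rw [countP_roots_charpoly_eq_card hH]
    simpa [Complex.ofReal_re] using key
  intro c hc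
  rw [Fintype.linearCombination_apply, mulVec_sum]
  simp_rw [mulVec_smul]
  rw [← re_star_dotProduct_self, ← re_star_dotProduct_self,
    wellBudget_re_star_dotProduct_sum_smul φ c hφorth,
    wellBudget_re_star_dotProduct_sum_smul (fun a => H *ᵥ φ a) c hHorth, Finset.mul_sum]
  -- each summand is `‖cₐ‖² ‖Hφₐ‖² ≤ E² ‖cₐ‖² ‖φₐ‖²`, strictly for some `cₐ ≠ 0`
  obtain ⟨a₀, ha₀⟩ : ∃ a, c a ≠ 0 := Function.ne_iff.mp hc
  refine Finset.sum_lt_sum (fun a _ => ?_) ⟨a₀, Finset.mem_univ _, ?_⟩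
  · have h1 := hquasi a
    nlinarith [sq_nonneg ‖c a‖]
  · have h1 := hquasi a₀
    have h2 : 0 < ‖c a₀‖ ^ 2 := by positivity
    nlinarith

end Summit.QuantumFields.QCD.Cruxes.ExtinctionBuildsQCD.BlockAwayTheSign

end
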